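import Literature.NumberTheory.EllipticCurves.HeegnerPointsKolyvaginConjugation
import Literature.NumberTheory.EllipticCurves.RingClassFieldTwoTorsionProofs
import Summits.BirchSwinnertonDyer.Rank1Residual.P2.CMKolyvaginHabitatImageAtTwo
import HarnessLib

/-!
# Complex conjugation is of TRANSPOSITION type on `E[2]` when `Δ_E < 0` — the input `hv₂` of the
# `p = 2` eigen-line algebra (`Theorems/CMKolyvaginAtInertTwoEigenPairingAtTwo.lean`) on the whole
# habitat H₂ of route CMKolyvaginAtInertTwo (crux 22836)

Seat `bsd-line-cmk2-p1` g2 (cell `bsd-print-cf2`). Summit-side THEOREM-ONLY file (no definition, no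
named fact, no `sorry`).

At an odd prime `p` complex conjugation `c₀` has BOTH eigenvalues `±1` on `E[p]` (the tree's
`RatClosure.exists_eigenvectors`, from `det = χ̄_p(c₀) = −1 ≠ 1` via the Weil pairing; McCallum §3).
At `p = 2` this argument is void (`−1 = 1`), and indeed `c₀` acts TRIVIALLY on `E[2]` iff all three
`2`-division abscissae are real iff `Δ_E > 0`. This file proves the `p = 2` replacement:

* `exists_twoTorsion_smul_ne_of_Δ_neg` — **if `Δ(W) < 0` then some `v ∈ E(ℚ̄)[2]` is MOVED by `c₀`**
  (`c₀ • v ≠ v`): otherwise the three roots `e₁, e₂, e₃ ∈ ℚ̄` of the `2`-division cubic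
  `4x³ + b₂x² + 2b₄x + b₆` are the abscissae of the non-zero `2`-torsion points, all fixed by `c₀`,
  hence real under the embedding `ι : ℚ̄ → ℂ` interchanging `c₀` and complex conjugation; then
  `16·Δ = disc = (16 (e₁−e₂)(e₁−e₃)(e₂−e₃))²` (Mathlib `Cubic.discr_eq_prod_three_roots`,
  `twoTorsionPolynomial_discr`) is the square of a REAL number, so `Δ ≥ 0` — contradiction.
  This is exactly the hypothesis `hv₂ : ι v₂ ≠ v₂` of
  `Theorems.KolyvaginEigenTwo.exists_eigen_generators_two` / `descent_step_two`.
* `Δ_neg_of_cmInert_two` — on H₂ (`CMInert W 2` and `ρ̄_{W,2}` onto) `Δ(W) < 0`: by lit g11's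
  `exists_Δ_eq_mul_sq_of_cmInert_two` (`Δ = d·s²`, `d = ±q`, `q = |d_F|`) refined to the sign:
  `Δ·(j − 1728) = c₆²` with `j − 1728 < 0` for the seven `CMInert 2` invariants `j ≠ 54000`, and
  `j = 54000` is excluded by surjectivity (rational `2`-torsion); `j = 0`: `1728Δ = −c₆²`.
  Hence `exists_twoTorsion_smul_ne_of_cmInert_two`: on H₂ complex conjugation moves a `2`-torsion point.

HONEST FRAMING. Elementary; supplies one displayed hypothesis of the `p = 2` leaf-(B) algebra for
every member of H₂ (and for every `E/ℚ` with `Δ < 0`, e.g. the Δ < 0 members of route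
GenusKolyvaginAtTwo's habitat). Nothing about `Ш`; no item closed; BSD is not proved by this.
References: [SilvermanAEC2009] III.1 (2-division cubic), [McCallumLMS1991] §3 (p odd analogue),
[DokchitserDokchitserMathZ2012] Thm (1) (`ℚ(E[2]) ⊃ ℚ(√Δ)`).
-/

set_option autoImplicit false
set_option linter.dupNamespace false

noncomputable section

open scoped Classical

namespace Summit.BirchSwinnertonDyer.BirchSwinnertonDyer.Theorems.KolyvaginEigenTwo

open Polynomial WeierstrassCurve Field
open Literature.NumberTheory.EllipticCurves Literature.NumberTheory.GaloisRepresentations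
open Literature.NumberTheory.EllipticCurves.Rank1Residual

variable (W : WeierstrassCurve ℚ) [W.IsElliptic]

/-! ### §1 A root of the `2`-division cubic over `ℚ̄` is the abscissa of a `2`-torsion point -/

omit [W.IsElliptic] in
/-- The `2`-division cubic commutes with base change to `ℚ̄`, as a `Cubic`. [folklore] -/
private theorem twoTorsionPolynomial_baseChange_eq_map :
    (W.baseChange (AlgebraicClosure ℚ)).twoTorsionPolynomial =
      Cubic.map (algebraMap ℚ (AlgebraicClosure ℚ)) W.twoTorsionPolynomial := by
  simp [baseChange, twoTorsionPolynomial, Cubic.map, map_b₂, map_b₄, map_b₆, map_ofNat]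

/-- **From a root `e ∈ ℚ̄` of `4x³ + b₂x² + 2b₄x + b₆` to a point of order `2` with abscissa `e`**:
`(e, −(a₁e + a₃)/2)` lies on `E` (the cubic is `(2y + a₁x + a₃)²` restricted to the curve) and equals
its own negative. [cite: SilvermanAEC2009, III.1 and III.2.3(d)] -/
theorem exists_point_two_smul_eq_zero_of_isRoot {e : AlgebraicClosure ℚ}
    (he : (W.baseChange (AlgebraicClosure ℚ)).twoTorsionPolynomial.toPoly.IsRoot e) :
    ∃ (y : AlgebraicClosure ℚ) (h : (W.baseChange (AlgebraicClosure ℚ)).toAffine.Nonsingular e y),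
      (2 : ℤ) • (Affine.Point.some e y h : geomPoints W) = 0 := by
  haveI : (W.baseChange (AlgebraicClosure ℚ)).IsElliptic := by rw [baseChange]; infer_instance
  have hroot : 4 * e ^ 3 + (W.baseChange (AlgebraicClosure ℚ)).b₂ * e ^ 2 +
      2 * (W.baseChange (AlgebraicClosure ℚ)).b₄ * e + (W.baseChange (AlgebraicClosure ℚ)).b₆ = 0 := by
    have := he
    simp only [twoTorsionPolynomial, Cubic.toPoly, IsRoot.def, eval_add, eval_mul, eval_C, eval_pow,
      eval_X] at this
    linear_combination this
  have hb₂ : (W.baseChange (AlgebraicClosure ℚ)).b₂ =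
      (W.baseChange (AlgebraicClosure ℚ)).a₁ ^ 2 + 4 * (W.baseChange (AlgebraicClosure ℚ)).a₂ := rfl
  have hb₄ : (W.baseChange (AlgebraicClosure ℚ)).b₄ =
      2 * (W.baseChange (AlgebraicClosure ℚ)).a₄ +
        (W.baseChange (AlgebraicClosure ℚ)).a₁ * (W.baseChange (AlgebraicClosure ℚ)).a₃ := rfl
  have hb₆ : (W.baseChange (AlgebraicClosure ℚ)).b₆ =
      (W.baseChange (AlgebraicClosure ℚ)).a₃ ^ 2 + 4 * (W.baseChange (AlgebraicClosure ℚ)).a₆ := rfl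
  rw [hb₂, hb₄, hb₆] at hroot
  have hns : (W.baseChange (AlgebraicClosure ℚ)).toAffine.Nonsingular e
      (-((W.baseChange (AlgebraicClosure ℚ)).a₁ * e + (W.baseChange (AlgebraicClosure ℚ)).a₃) / 2) := by
    rw [← Affine.equation_iff_nonsingular, Affine.equation_iff]
    linear_combination (-(1:AlgebraicClosure ℚ) / 4) * hroot
  refine ⟨_, hns, ?_⟩
  have hneg : -(Affine.Point.some _ _ hns : geomPoints W) = Affine.Point.some _ _ hns := by
    change -(Affine.Point.some _ _ hns : (W.baseChange (AlgebraicClosure ℚ)).toAffine.Point) =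
      Affine.Point.some _ _ hns
    rw [Affine.Point.neg_some]
    congr 1
    change -(-((W.baseChange (AlgebraicClosure ℚ)).a₁ * e +
        (W.baseChange (AlgebraicClosure ℚ)).a₃) / 2) - (W.baseChange (AlgebraicClosure ℚ)).a₁ * e -
        (W.baseChange (AlgebraicClosure ℚ)).a₃ = _
    ring
  have h0 := neg_add_cancel (Affine.Point.some _ _ hns : geomPoints W)
  rw [hneg] at h0
  rwa [two_zsmul]

/-! ### §2 `Δ < 0` forces complex conjugation to move a `2`-torsion point -/

/-- **Complex conjugation is of transposition type on `E[2]` when `Δ_E < 0`.** For `W/ℚ` elliptic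
with `Δ(W) < 0` and `c₀ ∈ Gal(ℚ̄/ℚ)` a complex conjugation, some `v ∈ E(ℚ̄)[2]` has `c₀ • v ≠ v`.
(If `c₀` fixed `E[2]` pointwise, the three abscissae `e_i` of the non-zero `2`-torsion points —
the roots of the `2`-division cubic in `ℚ̄` — would be `c₀`-fixed, hence real under `ι : ℚ̄ → ℂ`
with `ι ∘ c₀ = conj ∘ ι`, and `16Δ = (16∏_{i<j}(e_i − e_j))²` would be the square of a real
number, so `Δ ≥ 0`.) The `p = 2` counterpart of the tree's `RatClosure.exists_eigenvectors`
(`p` odd). [cite: SilvermanAEC2009, III.1] [cite: McCallumLMS1991, §3 (p odd analogue)] -/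
theorem exists_twoTorsion_smul_ne_of_Δ_neg (hΔ : W.Δ < 0) {c₀ : absoluteGaloisGroup ℚ}
    (hc₀ : IsComplexConjugation (Rat.castHom ℝ) c₀) :
    ∃ v : geomTorsion W 2, c₀ • v ≠ v := by
  by_contra hall
  push Not at hall
  obtain ⟨ι, -, hι⟩ := isComplexConjugation_iff.mp hc₀
  -- the cubic splits in `ℚ̄`
  have ha : W.twoTorsionPolynomial.a ≠ 0 := by change (4 : ℚ) ≠ 0; norm_num
  have hsplit : (W.twoTorsionPolynomial.toPoly.map (algebraMap ℚ (AlgebraicClosure ℚ))).Splits :=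
    IsAlgClosed.splits _
  obtain ⟨e₁, e₂, e₃, h3⟩ := (Cubic.splits_iff_roots_eq_three ha).mp hsplit
  -- every root is `c₀`-fixed
  have ha' : (Cubic.map (algebraMap ℚ (AlgebraicClosure ℚ)) W.twoTorsionPolynomial).a ≠ 0 := by
    change algebraMap ℚ (AlgebraicClosure ℚ) W.twoTorsionPolynomial.a ≠ 0
    exact (_root_.map_ne_zero _).mpr ha
  have hne0 : (Cubic.map (algebraMap ℚ (AlgebraicClosure ℚ)) W.twoTorsionPolynomial).toPoly ≠ 0 :=
    Cubic.ne_zero_of_a_ne_zero ha'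
  have hfix : ∀ e ∈ (Cubic.map (algebraMap ℚ (AlgebraicClosure ℚ)) W.twoTorsionPolynomial).roots,
      c₀ • e = e := by
    intro e he
    have hroot : (Cubic.map (algebraMap ℚ (AlgebraicClosure ℚ)) W.twoTorsionPolynomial).toPoly.IsRoot e :=
      (mem_roots hne0).mp he
    rw [← twoTorsionPolynomial_baseChange_eq_map] at hroot
    obtain ⟨y, hns, h2⟩ := exists_point_two_smul_eq_zero_of_isRoot W hroot
    set P : geomPoints W := Affine.Point.some e y hns with hP
    have hPmem : P ∈ geomTorsion W 2 := (mem_geomTorsion_iff W 2 P).mpr h2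
    have hv := hall ⟨P, hPmem⟩
    have hv' : c₀ • P = P := congrArg Subtype.val hv
    have hmap : c₀ • P = Affine.Point.map ((absoluteGaloisGroup.toAlgEquiv ℚ c₀).toAlgHom) P := rfl
    rw [hmap, hP, Affine.Point.map_some] at hv'
    injection hv' with hx hy
  have h1 : c₀ • e₁ = e₁ := hfix e₁ (by rw [h3]; simp)
  have h2 : c₀ • e₂ = e₂ := hfix e₂ (by rw [h3]; simp)
  have h3' : c₀ • e₃ = e₃ := hfix e₃ (by rw [h3]; simp)
  -- hence real under `ι`
  have hreal : ∀ {e : AlgebraicClosure ℚ}, c₀ • e = e → starRingEnd ℂ (ι e) = ι e := fun {e} he ↦ by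
    rw [← hι e, he]
  -- `16 Δ = (16 (e₁-e₂)(e₁-e₃)(e₂-e₃))²` in `ℚ̄`, hence in `ℂ`
  have hdisc := Cubic.discr_eq_prod_three_roots ha h3
  rw [twoTorsionPolynomial_discr] at hdisc
  have ha4 : W.twoTorsionPolynomial.a = 4 := rfl
  rw [ha4] at hdisc
  set δ : AlgebraicClosure ℚ := algebraMap ℚ (AlgebraicClosure ℚ) 4 * algebraMap ℚ (AlgebraicClosure ℚ) 4 *
    (e₁ - e₂) * (e₁ - e₃) * (e₂ - e₃) with hδ
  have hδreal : starRingEnd ℂ (ι δ) = ι δ := by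
    simp only [hδ, map_mul, map_sub, map_ofNat, hreal h1, hreal h2, hreal h3']
  have hC : ((16 * W.Δ : ℚ) : ℂ) = (ι δ) ^ 2 := by
    have := congrArg ι hdisc
    rw [map_pow, eq_ratCast, map_ratCast] at this
    exact this
  -- a complex number fixed by conjugation with square a rational: that rational is `≥ 0`
  obtain ⟨r, hr⟩ : ∃ r : ℝ, (r : ℂ) = ι δ := Complex.conj_eq_iff_real.mp hδreal |>.imp fun r h ↦ h.symm
  have hsq : ((16 * W.Δ : ℚ) : ℝ) = r ^ 2 := by
    have h' : (((16 * W.Δ : ℚ) : ℝ) : ℂ) = ((r ^ 2 : ℝ) : ℂ) := by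
      rw [Complex.ofReal_ratCast, hC, ← hr, Complex.ofReal_pow]
    exact_mod_cast h'
  have hnonneg : (0 : ℝ) ≤ ((16 * W.Δ : ℚ) : ℝ) := by rw [hsq]; positivity
  have : (0 : ℚ) ≤ 16 * W.Δ := by exact_mod_cast hnonneg
  linarith

/-! ### §3 On the habitat H₂: `Δ < 0`, so conjugation is of transposition type -/

/-- **On H₂ the discriminant is negative**: `CMInert W 2` (CM field `F` with `2` inert, so
`j ∈ {0, 54000, −12288000, −32768, −884736, −884736000, −147197952000, −262537412640768000}`) and
`ρ̄_{W,2}` onto (which excludes `j = 54000`, the one value with a rational `2`-torsion point /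
positive `Δ`) give `Δ(W) < 0`: `Δ·(j − 1728) = c₆²` with `j − 1728 < 0` for the six values
`j ∉ {0, 54000}`, and `1728Δ = −c₆²` for `j = 0` (`c₄ = 0`); `c₆ ≠ 0` as `Δ ≠ 0`.
[cite: SilvermanAEC2009, III.1 (c₄³ − c₆² = 1728Δ)] [cite: SilvermanATAEC1994, App. A §3] -/
theorem Δ_neg_of_cmInert_two (hCM : W.HasCM) (hin : CMInert W 2)
    (hsurj : W.HasSurjectiveModNGaloisRep 2) : W.Δ < 0 := by
  have hΔ0 : W.Δ ≠ 0 := by rw [← coe_Δ']; exact W.Δ'.ne_zero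
  have hjmem := j_mem_of_cmInert_two W hin
  -- `j ≠ 54000`: that class has a rational `2`-torsion point (surjectivity fails)
  have hj54 : W.j ≠ 54000 :=
    ((Summit.BirchSwinnertonDyer.Rank1Residual.P2.hasSurjectiveModNGaloisRep_two_iff_of_cmInert_two
      W hCM hin).mp hsurj).1
  have hrel : W.Δ * (W.j - 1728) = W.c₆ ^ 2 := Δ_mul_j_sub_eq_c₆_sq W
  rcases hjmem with hj | hj | hj | hj | hj | hj | hj | hj
  · -- `j = 0`: `c₄ = 0`, `1728 Δ = -c₆²`
    have hc4 : W.c₄ = 0 := (j_eq_zero_iff (W := W)).mp hj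
    have h1728 : 1728 * W.Δ = -W.c₆ ^ 2 := Δ_eq_of_c₄_eq_zero W hc4
    have hc6 : W.c₆ ≠ 0 := by
      intro h0; apply hΔ0
      have : 1728 * W.Δ = 0 := by rw [h1728, h0]; ring
      linarith [this]
    nlinarith [sq_pos_of_ne_zero hc6]
  · exact absurd hj hj54
  all_goals
    rw [hj] at hrel
    have hc6 : W.c₆ ≠ 0 := by
      intro h0
      rw [h0] at hrel
      have : W.Δ = 0 := by nlinarith [hrel]
      exact hΔ0 this
    nlinarith [sq_pos_of_ne_zero hc6]

/-- **On H₂ complex conjugation moves a `2`-torsion point** (transposition type), for every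
complex conjugation `c₀ ∈ Gal(ℚ̄/ℚ)`: the input `hv₂` of `exists_eigen_generators_two` /
`descent_step_two` is automatic on the habitat of `CMKolyvaginExactAtInertTwo`.
[cite: SilvermanAEC2009, III.1] [cite: McCallumLMS1991, §3 (p odd analogue)] -/
theorem exists_twoTorsion_smul_ne_of_cmInert_two (hCM : W.HasCM) (hin : CMInert W 2)
    (hsurj : W.HasSurjectiveModNGaloisRep 2) {c₀ : absoluteGaloisGroup ℚ}
    (hc₀ : IsComplexConjugation (Rat.castHom ℝ) c₀) : ∃ v : geomTorsion W 2, c₀ • v ≠ v :=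
  exists_twoTorsion_smul_ne_of_Δ_neg W (Δ_neg_of_cmInert_two W hCM hin hsurj) hc₀

end Summit.BirchSwinnertonDyer.BirchSwinnertonDyer.Theorems.KolyvaginEigenTwo

end
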